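import Summits.QuantumFields.BalabanUV.Beta.GAN24.BornLambdaBracketLetter

/-!
# `GAN24.BornLambdaBracketPair` — CT-ROUTE, the born-Λ RATE half («(C4)-DIFF», leaf-01 g61's `BORN-CONTACT-DIFF-PLAN-v0.md` §4 (Lbr), module D1):
# **THE BRACKET OF THE CONTACT CELLS FOR TWO CONSECUTIVE TOP-ALIGNED LINEAGES DIFFERS BY `θ_K^{i+m} ×` THE BRACKET LETTER** (`d = 3`)

NOT IN PRINT; OUR BOOKKEEPING (G-an2-4 formalisation swarm, leaf prover `b2b-balaban-gan24-formalise-leaf-01`, gen 61; INTENT «(C4)-DIFF» journal `CLAIMS.log` l.35799, «MINE (D1)»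
l.35821).  HONEST FRAMING (cell contract, verbatim): «discharging `BetaPertH` makes Bałaban's UV stability UNCONDITIONAL — a real constructive-QFT result; it is NOT the
continuum limit and NOT the Clay problem.»  HONEST DEPENDENCY (verbatim): «continuum YM on T⁴ ⇐ BetaPertH ∧ nine spine estimates (0/9 proved); BetaPertH ⇐ (D1) ∧ (D4) ∧ CAP+tail;
G-an2-4 gates asym, D1 and NE2/3/4.»

WHAT (`d = 3`, `2 ≤ Lc`, in-block root `ρ = toSite rr`).  In leaf-02 g48's factorised socket `ContactLambdaCellFactorised.contact_lambda_eq_factorised` the Λ contact term of the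
lineage born at level `i` with `m+1` dressed one-step legs (`T = legChain (respStepBmSeq ρ Lc) i m`, member `k = i+m+1`) sees its source ONLY through the BRACKET
`BR(i,m)(κ′u′; μ y) = Σ'_u Σ_κ T κ′u′ κ u·c_i μ y κ u`, `c_i = (−cΛ)·((Lc^i)^8·𝒬ᵀ_{Lc}[wΦ_{Lc^{i+1}}(·; μ; · − y)])` (gan24-p2 g33's `bornCoeff_succ_eq_tent` currency).  By p2's EXACT
identities `bracket_eq_of_one_step` (`m = 0`) ∕ `bracket_eq_tent_of_chain_three` (`m = n+1`), `BR(i,m) = (−cΛ)·((Lc^i)^8·𝒬ᵀ_{Lc^m}[wΦ_{Lc^{i+m+1}}(·, κ′, · − u′)](μ, y))` — the TOP-level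
multiplier kernel read through the birth-level tent.  TOP-ALIGNED, the next member's lineage born one level up, `BR(i+1,m)`, has the SAME `𝒬ᵀ_{Lc^m}` and, in units
`Φ^{(ℓ)} := (Lc^{ℓ+1})^8·wΦ_{Lc^{ℓ+1}}`, the SAME prefactor `(Lc^{m+1})^{−8}`: `BR(i+1,m) − BR(i,m) = (−cΛ)·(Lc^{m+1})^{−8}·𝒬ᵀ_{Lc^m}[Φ^{(i+m+1)} − Φ^{(i+m)}]` — ONE unit-kernel
increment, which is p2 g32's CT-4d Cauchy clause (`ContactTentCauchy.exists_unitTent_letters_three`, `hcau`, rate θ_K from the K-slot's `convCKWall_holds`).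
* §1 **`bracket_pair_le_of_unitTentCauchy`** (PARAMETRIC in the Cauchy data `cK, θ, δ` exactly as `exists_unitTent_letters_three` prints its second clause): for ALL `cΛ i m κ′ u′ μ y`,
  `|BR(i+1,m) − BR(i,m)| ≤ |cΛ|·(cK·e^{δ}·(Lc^8)⁻¹)·θ^{i+m}·((Lc^m)^7)⁻¹·e^{−δ‖quo (Lc^m) y − u′‖∞}` — `θ^{i+m} = θ^{k−1} ×` the undifferenced bracket letter's shape
  (p2's `bracket_letter_three_of_unitDecayK`: `|cΛ|·C·((Lc^m)^7)⁻¹·e^{…}`).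
* §2 **`exists_bracket_pair_letter_three`** — packaged, unconditional (`2 ≤ Lc`); **`exists_bracket_bornLam_succ_pair_letter_three`** — the same in the `lamCoeffK (KStepUnit …) (… • E2 …)`
  currency of leaf-02's (C4) ∕ leaf-01's `contact_bornLam_succ_eq_cells_three` (births `j+2` vs `j+1`, both `≥ 1`; the pair with birth `0` is leaf-06 g41's `exists_pairZero_lam_three`).
[folklore] throughout: gan24-p2's identities and CT-4d letters BY NAME + `abs_contourSumAdj_le_centre`; 0 `def`, 0 cited facts, 0 `def … : Prop`, 0 sorry.  NO estimate of Bałaban's;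
discharges NOTHING of hBdev(0,cΛ) ∕ hSdev by itself (it is the bracket-slot letter of the contact PAIR, plan §3; consumer: leaf-06 g41's `BornLambdaDrift.exists_hBdevLam_three_of_pairs`
through D2–D4); 0 wall binders; NEVER «G-an2-4 closed»; NOT D1, NOT BetaPertH, NOT continuum, NOT Clay.
-/

noncomputable section

open Finset
open scoped BigOperators
open Literature.MathematicalPhysics.QuantumFieldTheory
open Literature.MathematicalPhysics.QuantumFieldTheory.LatticeForm (quo)
open Literature.MathematicalPhysics.QuantumFieldTheory.Balaban1983to89
open Literature.MathematicalPhysics.QuantumFieldTheory.Balaban1983to89.Beta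
open B4ContourShift (supNorm supNorm_nonneg)
open B12Sec2to5 (l1 l1_nonneg)
open AffineAveraging (Form1 Site box toSite)
open AffineReproduction (contourSumAdj)
open KernelSpecInstance (wΦ)
open BalabanStepJetsSucc (E2 lamCoeffK)
open ResolventComposition (quo_one)
open Summit.QuantumFields.BalabanUV.Beta.GAN24.CombesThomas (smStep KStepUnit)
open Summit.QuantumFields.BalabanUV.Beta.GAN24.Push4Iter (legChain)
open Summit.QuantumFields.BalabanUV.Beta.GAN24.RespStepBmDecompExact (respStepBmSeq)
open Summit.QuantumFields.BalabanUV.Beta.GAN24.RespStepCauchy (supNorm_le_l1)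
open Summit.QuantumFields.BalabanUV.Beta.GAN24.BornLambdaTent (contourSumAdj_const_mul)
open Summit.QuantumFields.BalabanUV.Beta.GAN24.ContactTentCauchy (exists_unitTent_letters_three)
open Summit.QuantumFields.BalabanUV.Beta.GAN24.ContactTentRefine (abs_contourSumAdj_le_centre contourSumAdj_sub)
open Summit.QuantumFields.BalabanUV.Beta.GAN24.BornLambdaBracketLetter (wΦ_congrN bornCoeff_succ_eq_tent supNorm_sub_comm bracket_eq_of_one_step
  bracket_eq_tent_of_chain_three)

namespace Summit.QuantumFields.BalabanUV.Beta.GAN24.BornLambdaBracketPair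

variable {Lc : ℕ} [NeZero Lc]

/-! ## §1 The bracket pair from the unit-kernel Cauchy letter (parametric) -/

/-- NOT IN PRINT; OUR BOOKKEEPING.  **THE BRACKET PAIR LETTER, PARAMETRIC** (`d = 3`, `2 ≤ Lc`, in-block root; the unit-kernel Cauchy data `cK, θ, δ` exactly as the second
clause of `ContactTentCauchy.exists_unitTent_letters_three` prints it): for ALL `cΛ`, births `i`, chain lengths `m`, legs `(κ′, u′)`, source bonds `(μ, y)`,
`|BR(i+1,m) − BR(i,m)| ≤ |cΛ|·(cK·e^{δ}·(Lc^8)⁻¹)·θ^{i+m}·((Lc^m)^7)⁻¹·e^{−δ‖quo (Lc^m) y − u′‖∞}` — one step (`m = 0`: both brackets are unit columns, `quo 1 y = y`) and chain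
(`m = n+1`: both are `𝒬ᵀ_{Lc^{n+1}}` of top unit kernels with the SAME prefactor `(Lc^{n+2})^{−8}`) alike. -/
theorem bracket_pair_le_of_unitTentCauchy (hLc : 2 ≤ Lc) {cK θ δ : ℝ} (hδ : 0 < δ) (hcK : 0 ≤ cK) (hθ : 0 ≤ θ)
    (hcau : ∀ (k j : ℕ) (κ μ : Fin (3 + 1)) (y z : Fin (3 + 1) → ℤ),
      |(((Lc : ℝ) ^ (k + j + 1)) ^ (2 * (3 + 1))) * wΦ (N := Lc ^ (k + j + 1)) (d := 3) κ μ (y - z)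
          - (((Lc : ℝ) ^ (k + 1)) ^ (2 * (3 + 1))) * wΦ (N := Lc ^ (k + 1)) (d := 3) κ μ (y - z)|
        ≤ cK * θ ^ k * Real.exp (-δ * l1 (y - z)))
    {rr : Fin (3 + 1) → ℕ} (hrr : rr ∈ box (3 + 1) Lc) (cΛ : ℝ) (i m : ℕ) (κ' : Fin (3 + 1)) (u' : Site (3 + 1)) (μ : Fin (3 + 1))
    (y : Site (3 + 1)) :
    |(∑' u, ∑ κ, legChain (respStepBmSeq (d := 3) (toSite rr) Lc) (i + 1) m κ' u' κ u *
        ((-cΛ) * ((((Lc : ℝ) ^ (i + 1)) ^ (2 * (3 + 1))) *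
          contourSumAdj Lc (fun κ'' q => wΦ (N := Lc ^ (i + 1 + 1)) (d := 3) κ'' μ (q - y)) κ u)))
      - ∑' u, ∑ κ, legChain (respStepBmSeq (d := 3) (toSite rr) Lc) i m κ' u' κ u *
        ((-cΛ) * ((((Lc : ℝ) ^ i) ^ (2 * (3 + 1))) *
          contourSumAdj Lc (fun κ'' q => wΦ (N := Lc ^ (i + 1)) (d := 3) κ'' μ (q - y)) κ u))|
      ≤ |cΛ| * (cK * Real.exp δ * (((Lc : ℝ) ^ (2 * (3 + 1))))⁻¹) * θ ^ (i + m) * ((((Lc : ℝ) ^ m) ^ (2 * 3 + 1))⁻¹) *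
          Real.exp (-(δ * supNorm (quo (Lc ^ m) y - u'))) := by
  have hL0 : (0 : ℝ) < Lc := by exact_mod_cast Nat.pos_of_ne_zero (NeZero.ne Lc)
  have hL8 : (0 : ℝ) < (Lc : ℝ) ^ (2 * (3 + 1)) := by positivity
  -- the ℓ¹ envelope weakened to ℓ∞ with one unit of slack `e^{δ}`
  have henv : ∀ v : Site (3 + 1), Real.exp (-δ * l1 v) ≤ Real.exp (-(δ * supNorm v)) := fun v => by
    rw [neg_mul]
    exact Real.exp_le_exp.2 (neg_le_neg (mul_le_mul_of_nonneg_left (supNorm_le_l1 _) hδ.le))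
  cases m with
  | zero =>
    -- both brackets are unit columns of their top kernels (one step each)
    rw [bracket_eq_of_one_step hrr cΛ (i + 1) κ' u' μ y, bracket_eq_of_one_step hrr cΛ i κ' u' μ y]
    have hc := hcau i 1 κ' μ u' y
    -- units: `(Lc^{i+1})^8 = (Lc^8)⁻¹·(Lc^{i+2})^8`, `(Lc^i)^8 = (Lc^8)⁻¹·(Lc^{i+1})^8`
    have e : (-cΛ) * ((((Lc : ℝ) ^ (i + 1)) ^ (2 * (3 + 1))) * wΦ (N := Lc ^ (i + 1 + 1)) (d := 3) κ' μ (u' - y))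
          - (-cΛ) * ((((Lc : ℝ) ^ i) ^ (2 * (3 + 1))) * wΦ (N := Lc ^ (i + 1)) (d := 3) κ' μ (u' - y))
        = (-cΛ) * (((Lc : ℝ) ^ (2 * (3 + 1)))⁻¹ *
            ((((Lc : ℝ) ^ (i + 1 + 1)) ^ (2 * (3 + 1))) * wΦ (N := Lc ^ (i + 1 + 1)) (d := 3) κ' μ (u' - y)
              - (((Lc : ℝ) ^ (i + 1)) ^ (2 * (3 + 1))) * wΦ (N := Lc ^ (i + 1)) (d := 3) κ' μ (u' - y))) := by
      field_simp
      ring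
    rw [e, abs_mul, abs_mul, abs_neg, abs_inv, abs_of_pos hL8, pow_zero, pow_zero, one_pow, inv_one, mul_one, add_zero, quo_one,
      supNorm_sub_comm]
    calc |cΛ| * ((((Lc : ℝ) ^ (2 * (3 + 1))))⁻¹ * |(((Lc : ℝ) ^ (i + 1 + 1)) ^ (2 * (3 + 1))) * wΦ (N := Lc ^ (i + 1 + 1)) (d := 3) κ' μ (u' - y)
              - (((Lc : ℝ) ^ (i + 1)) ^ (2 * (3 + 1))) * wΦ (N := Lc ^ (i + 1)) (d := 3) κ' μ (u' - y)|)
        ≤ |cΛ| * ((((Lc : ℝ) ^ (2 * (3 + 1))))⁻¹ * (cK * θ ^ i * (Real.exp δ * Real.exp (-(δ * supNorm (u' - y)))))) := by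
          refine mul_le_mul_of_nonneg_left (mul_le_mul_of_nonneg_left (hc.trans ?_) (by positivity)) (abs_nonneg _)
          refine mul_le_mul_of_nonneg_left ((henv _).trans ?_) (by positivity)
          exact le_mul_of_one_le_left (Real.exp_pos _).le (Real.one_le_exp hδ.le)
      _ = |cΛ| * (cK * Real.exp δ * (((Lc : ℝ) ^ (2 * (3 + 1))))⁻¹) * θ ^ i * Real.exp (-(δ * supNorm (u' - y))) := by ring
  | succ n =>
    -- both brackets are `𝒬ᵀ_{Lc^{n+1}}` of their top unit kernels with the same prefactor `(Lc^{n+2})^{−8}`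
    rw [bracket_eq_tent_of_chain_three hLc hrr cΛ (i + 1) n κ' u' μ y, bracket_eq_tent_of_chain_three hLc hrr cΛ i n κ' u' μ y]
    -- the kernel difference in units, as a 1-form in the tent variable
    set φ : Form1 (3 + 1) ℝ := fun κ q =>
      (((Lc : ℝ) ^ (i + n + 1 + 1 + 1)) ^ (2 * (3 + 1))) * wΦ (N := Lc ^ (i + n + 1 + 1 + 1)) (d := 3) κ κ' (q - u')
        - (((Lc : ℝ) ^ (i + n + 2)) ^ (2 * (3 + 1))) * wΦ (N := Lc ^ (i + n + 2)) (d := 3) κ κ' (q - u') with hφ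
    have hφb : ∀ κ q, |φ κ q| ≤ cK * θ ^ (i + n + 1) * Real.exp (-(δ * supNorm (q - u'))) := by
      intro κ q
      rw [hφ]
      exact (hcau (i + n + 1) 1 κ κ' q u').trans (mul_le_mul_of_nonneg_left (henv _) (by positivity))
    have hQ := abs_contourSumAdj_le_centre (N := Lc ^ (n + 1)) (by positivity : 0 ≤ cK * θ ^ (i + n + 1)) hδ.le u' hφb μ y
    -- the two tents as ONE tent of `φ`, with the common prefactor pulled out
    have e : (-cΛ) * ((((Lc : ℝ) ^ (i + 1)) ^ (2 * (3 + 1))) *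
            contourSumAdj (Lc ^ (n + 1)) (fun κ q => wΦ (N := Lc ^ (i + 1 + n + 2)) (d := 3) κ κ' (q - u')) μ y)
          - (-cΛ) * ((((Lc : ℝ) ^ i) ^ (2 * (3 + 1))) *
            contourSumAdj (Lc ^ (n + 1)) (fun κ q => wΦ (N := Lc ^ (i + n + 2)) (d := 3) κ κ' (q - u')) μ y)
        = (-cΛ) * ((((Lc : ℝ) ^ (n + 2)) ^ (2 * (3 + 1)))⁻¹ * contourSumAdj (Lc ^ (n + 1)) φ μ y) := by
      -- each tent as a scalar multiple of the tent of a UNIT kernel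
      have t1 : contourSumAdj (Lc ^ (n + 1)) (fun κ q => wΦ (N := Lc ^ (i + 1 + n + 2)) (d := 3) κ κ' (q - u')) μ y
          = ((((Lc : ℝ) ^ (i + n + 1 + 1 + 1)) ^ (2 * (3 + 1))))⁻¹ *
            contourSumAdj (Lc ^ (n + 1))
              (fun κ q => (((Lc : ℝ) ^ (i + n + 1 + 1 + 1)) ^ (2 * (3 + 1))) * wΦ (N := Lc ^ (i + n + 1 + 1 + 1)) (d := 3) κ κ' (q - u')) μ y := by
        rw [contourSumAdj_const_mul, ← mul_assoc, inv_mul_cancel₀ (by positivity), one_mul]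
        refine congrArg (fun ψ => contourSumAdj (Lc ^ (n + 1)) ψ μ y) ?_
        funext κ q
        exact wΦ_congrN (show Lc ^ (i + 1 + n + 2) = Lc ^ (i + n + 1 + 1 + 1) by ring_nf) κ κ' (q - u')
      have t2 : contourSumAdj (Lc ^ (n + 1)) (fun κ q => wΦ (N := Lc ^ (i + n + 2)) (d := 3) κ κ' (q - u')) μ y
          = ((((Lc : ℝ) ^ (i + n + 2)) ^ (2 * (3 + 1))))⁻¹ *
            contourSumAdj (Lc ^ (n + 1))
              (fun κ q => (((Lc : ℝ) ^ (i + n + 2)) ^ (2 * (3 + 1))) * wΦ (N := Lc ^ (i + n + 2)) (d := 3) κ κ' (q - u')) μ y := by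
        rw [contourSumAdj_const_mul, ← mul_assoc, inv_mul_cancel₀ (by positivity), one_mul]
      rw [t1, t2, hφ, ← contourSumAdj_sub]
      field_simp
      first | done | ring
    rw [e, abs_mul, abs_mul, abs_neg, abs_inv, abs_of_pos (by positivity : (0 : ℝ) < ((Lc : ℝ) ^ (n + 2)) ^ (2 * (3 + 1)))]
    calc |cΛ| * (((((Lc : ℝ) ^ (n + 2)) ^ (2 * (3 + 1))))⁻¹ * |contourSumAdj (Lc ^ (n + 1)) φ μ y|)
        ≤ |cΛ| * (((((Lc : ℝ) ^ (n + 2)) ^ (2 * (3 + 1))))⁻¹ *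
            ((((Lc ^ (n + 1) : ℕ) : ℝ)) * (cK * θ ^ (i + n + 1)) * Real.exp δ * Real.exp (-(δ * supNorm (quo (Lc ^ (n + 1)) y - u'))))) :=
          mul_le_mul_of_nonneg_left (mul_le_mul_of_nonneg_left hQ (by positivity)) (abs_nonneg _)
      _ = |cΛ| * (cK * Real.exp δ * (((Lc : ℝ) ^ (2 * (3 + 1))))⁻¹) * θ ^ (i + (n + 1)) * ((((Lc : ℝ) ^ (n + 1)) ^ (2 * 3 + 1))⁻¹) *
            Real.exp (-(δ * supNorm (quo (Lc ^ (n + 1)) y - u'))) := by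
          have e4 : (((Lc : ℝ) ^ (n + 2)) ^ (2 * (3 + 1))) = ((Lc : ℝ) ^ (2 * (3 + 1))) * (((Lc : ℝ) ^ (n + 1)) ^ (2 * 3 + 1)) * ((Lc : ℝ) ^ (n + 1)) := by
            rw [← pow_mul, ← pow_mul, ← pow_add, ← pow_add]; ring_nf
          push_cast
          rw [e4, show i + (n + 1) = i + n + 1 by ring]
          field_simp
          ring

/-! ## §2 `d = 3`: packaged, and in the `lamCoeffK` currency of the (C4) cells -/

/-- NOT IN PRINT; OUR BOOKKEEPING.  **THE BRACKET PAIR LETTER, UNCONDITIONAL** (`d = 3`, `2 ≤ Lc`): the K-slot's all-scales letter (through p2's `exists_unitTent_letters_three`)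
gives `C ≥ 0`, `δ > 0`, `0 ≤ θ < 1` with, for EVERY in-block root, EVERY `cΛ`, ALL `i m κ′ u′ μ y`,
`|BR(i+1,m) − BR(i,m)| ≤ |cΛ|·C·θ^{i+m}·((Lc^m)^7)⁻¹·e^{−δ‖quo (Lc^m) y − u′‖∞}`. -/
theorem exists_bracket_pair_letter_three (hLc : 2 ≤ Lc) :
    ∃ C δ θ : ℝ, 0 ≤ C ∧ 0 < δ ∧ 0 ≤ θ ∧ θ < 1 ∧ ∀ (rr : Fin (3 + 1) → ℕ), rr ∈ box (3 + 1) Lc → ∀ (cΛ : ℝ) (i m : ℕ),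
      ∀ (κ' : Fin (3 + 1)) (u' : Site (3 + 1)) (μ : Fin (3 + 1)) (y : Site (3 + 1)),
        |(∑' u, ∑ κ, legChain (respStepBmSeq (d := 3) (toSite rr) Lc) (i + 1) m κ' u' κ u *
            ((-cΛ) * ((((Lc : ℝ) ^ (i + 1)) ^ (2 * (3 + 1))) *
              contourSumAdj Lc (fun κ'' q => wΦ (N := Lc ^ (i + 1 + 1)) (d := 3) κ'' μ (q - y)) κ u)))
          - ∑' u, ∑ κ, legChain (respStepBmSeq (d := 3) (toSite rr) Lc) i m κ' u' κ u *
            ((-cΛ) * ((((Lc : ℝ) ^ i) ^ (2 * (3 + 1))) *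
              contourSumAdj Lc (fun κ'' q => wΦ (N := Lc ^ (i + 1)) (d := 3) κ'' μ (q - y)) κ u))|
          ≤ |cΛ| * C * θ ^ (i + m) * ((((Lc : ℝ) ^ m) ^ (2 * 3 + 1))⁻¹) * Real.exp (-(δ * supNorm (quo (Lc ^ m) y - u'))) := by
  obtain ⟨C, δ, cK, θ, hδ, hθ0, hθ1, -, hcau⟩ := exists_unitTent_letters_three (Lc := Lc) hLc
  -- `cK ≥ 0`, read off at one point
  have hcK : 0 ≤ cK := by
    have h := hcau 0 0 0 0 0 0
    rw [sub_self, abs_zero, pow_zero, mul_one] at h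
    have hpos : 0 < Real.exp (-δ * l1 ((0 : Fin (3 + 1) → ℤ) - 0)) := Real.exp_pos _
    nlinarith
  exact ⟨cK * Real.exp δ * (((Lc : ℝ) ^ (2 * (3 + 1))))⁻¹, δ, θ, by positivity, hδ, hθ0, hθ1,
    fun rr hrr cΛ i m κ' u' μ y => bracket_pair_le_of_unitTentCauchy hLc hδ hcK hθ0 hcau hrr cΛ i m κ' u' μ y⟩

/-- NOT IN PRINT; OUR BOOKKEEPING.  **THE SAME IN THE (C4) CELLS' `lamCoeffK` CURRENCY** (`d = 3`, `2 ≤ Lc`; births `j+2` vs `j+1`, chain length `m` free — the consumer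
instantiates `m := k − 2 − j`): for EVERY in-block root, EVERY `cΛ`, ALL `j m κ′ u′ μ y`,
`|Σ'_u Σ_κ T_{j+2,m} κ′u′ κ u·c_{j+2} μ y κ u − Σ'_u Σ_κ T_{j+1,m} κ′u′ κ u·c_{j+1} μ y κ u| ≤ |cΛ|·C·θ^{j+1+m}·((Lc^m)^7)⁻¹·e^{−δ‖quo (Lc^m) y − u′‖∞}`,
`c_{j+1} μ y κ u = (cΛ·Lc^8)·lamCoeffK (KStepUnit Lc (j+1)) ((smStep 3 Lc j)²•E2 3 Lc (j+1)) Lc μ y κ u` (p2's `bornCoeff_succ_eq_tent` on both members). -/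
theorem exists_bracket_bornLam_succ_pair_letter_three (hLc : 2 ≤ Lc) :
    ∃ C δ θ : ℝ, 0 ≤ C ∧ 0 < δ ∧ 0 ≤ θ ∧ θ < 1 ∧ ∀ (rr : Fin (3 + 1) → ℕ), rr ∈ box (3 + 1) Lc → ∀ (cΛ : ℝ) (j m : ℕ),
      ∀ (κ' : Fin (3 + 1)) (u' : Site (3 + 1)) (μ : Fin (3 + 1)) (y : Site (3 + 1)),
        |(∑' u, ∑ κ, legChain (respStepBmSeq (d := 3) (toSite rr) Lc) (j + 1 + 1) m κ' u' κ u *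
            ((cΛ * (Lc : ℝ) ^ (2 * (3 + 1))) *
              lamCoeffK (KStepUnit (d := 3) Lc (j + 1 + 1)) ((smStep 3 Lc (j + 1)) ^ 2 • E2 3 Lc (j + 1 + 1)) Lc μ y κ u))
          - ∑' u, ∑ κ, legChain (respStepBmSeq (d := 3) (toSite rr) Lc) (j + 1) m κ' u' κ u *
            ((cΛ * (Lc : ℝ) ^ (2 * (3 + 1))) *
              lamCoeffK (KStepUnit (d := 3) Lc (j + 1)) ((smStep 3 Lc j) ^ 2 • E2 3 Lc (j + 1)) Lc μ y κ u)|
          ≤ |cΛ| * C * θ ^ (j + 1 + m) * ((((Lc : ℝ) ^ m) ^ (2 * 3 + 1))⁻¹) * Real.exp (-(δ * supNorm (quo (Lc ^ m) y - u'))) := by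
  obtain ⟨C, δ, θ, hC, hδ, hθ0, hθ1, H⟩ := exists_bracket_pair_letter_three (Lc := Lc) hLc
  refine ⟨C, δ, θ, hC, hδ, hθ0, hθ1, fun rr hrr cΛ j m κ' u' μ y => ?_⟩
  simp only [bornCoeff_succ_eq_tent]
  exact H rr hrr cΛ (j + 1) m κ' u' μ y

end Summit.QuantumFields.BalabanUV.Beta.GAN24.BornLambdaBracketPair

end
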